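import Summits.Langlands.Langlands.Theorems.SkinnerWilesDefectOneProModularOrdinaryClassicalSlopeZeroFactorisation
import Literature.NumberTheory.Automorphic.HidaTowerHeckeCommutative
import HarnessLib

/-!
# Route `SkinnerWilesDefectOne`, crux `ProModularOrdinaryClassical` (stmt-Langlands-12921), line
# `top-degree-exact-control`: an ordinary point is a slope-zero Iwahori point (converse of KT 2.10)

Helper file (`--supports stmt-Langlands-12921`, registered sub-goal `isSlopeZeroAt_comp_toOrd`) of the checked skeleton
`Cruxes/ProModularOrdinaryClassical/Lines/top_degree_exact_control.lean` (rev 5, lead prover-line-stmt-Langlands-12921-c1-0).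
Rev 4/5 of the skeleton cut the transfer slot (OF⁺: "pro-modular Galois-ordinary `ρ` ⇒ a continuous point of Hida's ORDINARY
big Hecke algebra `𝕋^{S,ord}(𝒰)`") at Khare–Thorne's Lemma 2.10 into "⇒ a continuous SLOPE-ZERO point of the Iwahori-tower
algebra `𝕋^S(𝒰; p)`" (OF_Iw) followed by the landed factorisation `stub_slopeZeroFactorisation` (p98105).  This file proves the
converse direction, so that the cut is LOSSLESS (OF_Iw ⇔ OF⁺ given finiteness of the Hida-tower cohomology): for `𝒰` maximal
above `p` with finite `H^i(X_{U(r)}, ℤ/p^s)`, every continuous point `x` of `𝕋^{S,ord}(𝒰)` composed with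
`toOrd : 𝕋^S(𝒰; p) → 𝕋^{S,ord}(𝒰)` has slope zero at every `v ∣ p` — indeed `U_{v,1}^{m!} → 1` in `𝕋^{S,ord}(𝒰)`, because at
each index the ordinary part `H^{ord} ⊆ ⋂_m U_{v,1}^m H = e_v H` (`ordinaryPart_eq_iInf_range`,
`range_eq_iInf_range_pow_of_forall_pow_factorial_eq`) and `U_{v,1}^{m!} = e_v` acts as the identity on `e_v H` for `m ≫ 0`.
References: Khare–Thorne, Amer. J. Math. 139 (2017), §2.4 Lemma 2.10; Hida, Ann. Inst. Fourier 44 (1994), §2.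
-/

noncomputable section

namespace Summit.Langlands.Langlands.Theorems.SkinnerWilesDefectOne.SlopeZeroFactorisation

set_option linter.dupNamespace false

open Literature.NumberTheory.Automorphic Literature.NumberTheory.Automorphic.BigHeckeGLn
open NumberField IsDedekindDomain Filter Topology

variable {F : Type} [Field F] [NumberField F] {p : ℕ} [Fact p.Prime] (𝒰 : TameLevel 2 F p)

/-- **`U_{v,1}^{m!} → 1` in the ordinary algebra.** For `𝒰` maximal above `p` with finite Hida-tower cohomology and
`v ∣ p`, the powers `(ordT v 1)^{m!}` converge to `1` in `𝕋^{S,ord}(𝒰)`: at each index `ι`, Hida's idempotent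
`e = U_{v,1,ι}^{m!}` (`m ≥ N_ι`) has range `⋂_m U^m H ⊇ H^{ord}` and is the identity on its range.
[cite: KhareThorne2017, §2.4, Lemma 2.10] -/
theorem tendsto_ordT_pow_factorial (h𝒰 : 𝒰.IsMaximalAbove)
    (hfin : ∀ ι : TowerIndex, Finite (𝒰.hidaCohomology ℤ ι))
    {v : HeightOneSpectrum (𝓞 F)} (hv : (p : 𝓞 F) ∈ v.asIdeal) :
    Tendsto (fun m : ℕ => 𝒰.ordT v 1 ^ m.factorial) atTop (𝓝 1) := by
  haveI := fun ι => finite_hidaEndFactor 𝒰 hfin ι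
  have hpl : 𝒰.IsHidaPlace v := Or.inr hv
  -- levelwise idempotents of `U_{v,1}`
  choose e hidem N hN using fun ι : TowerIndex =>
    exists_isIdempotentElem_forall_pow_factorial_eq (𝒰.hidaFamily ℤ (heckeElement 2 F v 1) ι)
  -- the ordinary part lies in the range of `e ι`
  have hord : ∀ (ι : TowerIndex) (z : 𝒰.hidaCohomology ℤ ι), z ∈ 𝒰.ordinaryPart ℤ ι →
      z ∈ LinearMap.range (TameLevel.HidaEndFactor.toEnd 𝒰 ℤ (e ι)) := by
    intro ι z hz
    rw [range_eq_iInf_range_pow_of_forall_pow_factorial_eq (hN ι), Submodule.mem_iInf]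
    intro m
    rw [𝒰.ordinaryPart_eq_iInf_range h𝒰 ℤ ι, Submodule.mem_iInf] at hz
    have hz' := hz ⟨v, hv⟩
    rw [Submodule.mem_iInf] at hz'
    have hz'' := hz' ⟨0, by norm_num⟩
    rw [Submodule.mem_iInf] at hz''
    exact hz'' m
  -- `e ι` is the identity on its range
  have hid : ∀ (ι : TowerIndex) (z : 𝒰.hidaCohomology ℤ ι), z ∈ 𝒰.ordinaryPart ℤ ι → (e ι) z = z := by
    intro ι z hz
    obtain ⟨w, rfl⟩ := hord ι z hz
    change (e ι * e ι) w = (e ι) w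
    rw [(hidem ι).eq]
  -- the `ι`-component of `ordT v 1` is the restriction of `U_{v,1,ι}` to the ordinary part
  have hT : ∀ ι : TowerIndex, ((𝒰.ordT v 1 : OrdinaryHeckeAlgebraGLn 𝒰) : 𝒰.ordEndProd ℤ) ι =
      𝒰.restrictOrd ℤ ι ⟨𝒰.hidaFamily ℤ (heckeElement 2 F v 1) ι,
        𝒰.hidaFamily_apply_mem_hidaLevelSubring ℤ (𝒰.heckeElement_mem_hidaElements hpl 1) ι⟩ := by
    intro ι
    have h1 : 𝒰.ordT v 1 = 𝒰.ordOp (𝒰.heckeElement_mem_hidaElements hpl 1) := by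
      unfold TameLevel.ordT
      exact dif_pos hpl
    rw [h1]
    rfl
  -- powers of the restriction act as powers of `U_{v,1,ι}`
  have hpow : ∀ (ι : TowerIndex) (n : ℕ) (z : 𝒰.ordinaryPart ℤ ι),
      ((((𝒰.ordT v 1 : OrdinaryHeckeAlgebraGLn 𝒰) : 𝒰.ordEndProd ℤ) ι ^ n) z : 𝒰.hidaCohomology ℤ ι) =
        (𝒰.hidaFamily ℤ (heckeElement 2 F v 1) ι ^ n) (z : 𝒰.hidaCohomology ℤ ι) := by
    intro ι n
    induction n with
    | zero => intro z; rfl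
    | succ n ih =>
      intro z
      have h1 : ((((𝒰.ordT v 1 : OrdinaryHeckeAlgebraGLn 𝒰) : 𝒰.ordEndProd ℤ) ι) z : 𝒰.hidaCohomology ℤ ι) =
          (𝒰.hidaFamily ℤ (heckeElement 2 F v 1) ι) (z : 𝒰.hidaCohomology ℤ ι) := by
        rw [hT]
        rfl
      calc ((((𝒰.ordT v 1 : OrdinaryHeckeAlgebraGLn 𝒰) : 𝒰.ordEndProd ℤ) ι ^ (n + 1)) z : 𝒰.hidaCohomology ℤ ι)
          = ((((𝒰.ordT v 1 : OrdinaryHeckeAlgebraGLn 𝒰) : 𝒰.ordEndProd ℤ) ι ^ n)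
              ((((𝒰.ordT v 1 : OrdinaryHeckeAlgebraGLn 𝒰) : 𝒰.ordEndProd ℤ) ι) z) : 𝒰.hidaCohomology ℤ ι) := by
            rw [pow_succ]; rfl
        _ = (𝒰.hidaFamily ℤ (heckeElement 2 F v 1) ι ^ n)
              (((((𝒰.ordT v 1 : OrdinaryHeckeAlgebraGLn 𝒰) : 𝒰.ordEndProd ℤ) ι) z : 𝒰.hidaCohomology ℤ ι)) := ih _
        _ = (𝒰.hidaFamily ℤ (heckeElement 2 F v 1) ι ^ n)
              ((𝒰.hidaFamily ℤ (heckeElement 2 F v 1) ι) (z : 𝒰.hidaCohomology ℤ ι)) := by rw [h1]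
        _ = (𝒰.hidaFamily ℤ (heckeElement 2 F v 1) ι ^ (n + 1)) (z : 𝒰.hidaCohomology ℤ ι) := by
            rw [pow_succ]; rfl
  -- coordinatewise eventual equality `(ordT v 1)^{m!} = 1` in the product
  have hcoe : ∀ (m : ℕ) (ι : TowerIndex), N ι ≤ m →
      ((𝒰.ordT v 1 ^ m.factorial : OrdinaryHeckeAlgebraGLn 𝒰) : 𝒰.ordEndProd ℤ) ι = (1 : 𝒰.ordEndProd ℤ) ι := by
    intro m ι hm
    refine DFunLike.ext _ _ fun z => Subtype.ext ?_
    rw [Subring.coe_pow, Pi.pow_apply, Pi.one_apply, hpow ι _ z, hN ι m hm]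
    exact hid ι z z.2
  have hlim : Tendsto (fun m : ℕ => ((𝒰.ordT v 1 ^ m.factorial : OrdinaryHeckeAlgebraGLn 𝒰) : 𝒰.ordEndProd ℤ))
      atTop (𝓝 (1 : 𝒰.ordEndProd ℤ)) :=
    tendsto_pi_nhds.2 fun ι => tendsto_atTop_of_eventually_const (i₀ := N ι) fun m hm => hcoe m ι hm
  rw [tendsto_subtype_rng]
  simpa only [Subring.coe_one] using hlim

end Summit.Langlands.Langlands.Theorems.SkinnerWilesDefectOne.SlopeZeroFactorisation

namespace Summit.Langlands.Langlands.Cruxes.ProModularOrdinaryClassical.TopDegreeExactControl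

set_option linter.dupNamespace false

open Literature.NumberTheory.Automorphic Literature.NumberTheory.Automorphic.BigHeckeGLn
open NumberField IsDedekindDomain Filter Topology
open Summit.Langlands.Langlands.Theorems.SkinnerWilesDefectOne.SlopeZeroFactorisation

/-- **Registered helper `isSlopeZeroAt_comp_toOrd` — every continuous ordinary point is a slope-zero Iwahori point**
(converse of `stub_slopeZeroFactorisation`; together they make the rev-4/5 cut of the transfer slot lossless): for `𝒰`
maximal above `p` with finite Hida-tower cohomology and `x : 𝕋^{S,ord}(𝒰) → ℚ̄_p` continuous, `x ∘ toOrd` has slope zero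
at every `v ∣ p`, i.e. `x(U_{v,1})^{m!} → 1` (`toOrd U_{v,1} = U_{v,1}`, `U_{v,1}^{m!} → 1` in `𝕋^{S,ord}(𝒰)`, continuity of `x`).
[cite: KhareThorne2017, §2.4, Lemma 2.10] -/
theorem isSlopeZeroAt_comp_toOrd : ∀ (F : Type) [Field F] [NumberField F] (p : ℕ) [Fact p.Prime] (𝒰 : Literature.NumberTheory.Automorphic.BigHeckeGLn.TameLevel 2 F p), 𝒰.IsMaximalAbove → (∀ ι : Literature.NumberTheory.Automorphic.TowerIndex, Finite (𝒰.hidaCohomology ℤ ι)) → ∀ (x : Literature.NumberTheory.Automorphic.OrdinaryHeckeAlgebraGLn 𝒰 →+* PadicAlgCl p), Continuous x → ∀ v : IsDedekindDomain.HeightOneSpectrum (NumberField.RingOfIntegers F), (p : NumberField.RingOfIntegers F) ∈ v.asIdeal → 𝒰.IsSlopeZeroAt (x.comp (𝒰.toOrd ℤ)) v := by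
  intro F _ _ p _ 𝒰 h𝒰 hfin x hx v hv j hj1 hj2
  have hj : j = 1 := by omega
  subst hj
  have h := (hx.tendsto 1).comp (tendsto_ordT_pow_factorial 𝒰 h𝒰 hfin hv)
  rw [map_one] at h
  refine h.congr fun m => ?_
  simp only [Function.comp_apply, RingHom.comp_apply, TameLevel.toOrd_hidaT, map_pow]

end Summit.Langlands.Langlands.Cruxes.ProModularOrdinaryClassical.TopDegreeExactControl
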